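import Literature.MathematicalPhysics.QuantumFieldTheory.Balaban1983to89.Beta.RemainderChainTorus

/-!
# [Balaban1987RG1] (1.21)/(5.1): the limit `T₁ ↗ ℤ^d` of the polarization kernels EXISTS — derived on the periodic
carrier by dominated convergence from the chain's own leaves (`Beta.RemainderLimitTorus`)

HONEST FRAMING (cell rule, page 1 of everything).  Discharging `BetaPertH` makes Bałaban's UV stability UNCONDITIONAL —
a real constructive-QFT result; it is NOT the continuum limit and NOT the Clay problem.  This module discharges NOTHING
of `BetaPertH`; it converts ONE hypothesis FIELD of the torus leaf list `RemainderChainTorus.PolLeavesT` — the field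
`hlim`, the EXISTENCE of the limit (5.1) — into kernel-checked analysis modulo a strictly smaller, located clause.

ABSOLUTE RULE (cell).  "No internally-minted statement may enter as a cited fact. Every hypothesis is either
kernel-proved in this package or a verbatim quotation of a PUBLISHED theorem with page reference. The manuscript(s)
under audit are NOT citable for their own disputed steps — they are the thing under adjudication; programme-internal
(2001/route/tribunal) claims are never citable."  No `def … : Prop` fact is introduced here: every declaration is a
definition, a hypothesis STRUCTURE (whose fields are displayed hypotheses, never facts), or a proved theorem.

WHAT PRINT SAYS.  [Balaban1987RG1] p. 264, after (1.21), verbatim: *"Now we take a limit of these functions as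
T^{(j+1)} ↗ Z^d. This limit exists by the localized representation (1.7)."*; p. 291, verbatim: *"Π_{μν}(x, y) =
Σ_{X∈𝐃⁰_j} 𝐄^{(2)}_{μν}(X, x, y) (4.37) … The function Π is called the vacuum polarization tensor."* [𝐃⁰_j = p. 290:
*"the class of localization domains constructed for the lattice ξZ⁴"*]; p. 292, §5, first
sentences, verbatim: *"The vacuum polarization tensor is defined by the formula (4.37) of the previous section. From this
it follows that it can be defined also as"* [(5.1): the limit T₁^{(j)} ↗ Z⁴ of the finite-volume tensors].  The EXISTENCE
of the limit is ASSERTED in print, not written out; `RemainderChainTorus.PolLeavesT.hlim` carried it as a hypothesis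
field; `B12Limit51` closed only its SUBSEQUENTIAL half (compactness).  The torus ↔ lattice comparison of the ingredients
is the comparison print names (and does not pursue): *"relating G on the torus to G on the whole lattice ηZ^d in the usual
way"* ([Balaban1984PropagatorsI] p. 36).

WHAT THIS MODULE PROVES (kernel-checked; NO new condition: only `RemainderChainLattice.CondsL` (its `tree` clause
κ/2 ≥ κ₀(4·2^d, 2d)), `(1 − 10δ)ℓ = 1`, and the printed signs `SignsL` (δ₀ > 0, α₂ > 0, B₃ ≥ 0, C₃ε₁ ≥ 0)).
§1 `tendsto_sum_of_dominated_pullback` — Tannery's theorem (Mathlib `tendsto_tsum_of_dominated_convergence`) over a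
   sequence of FINITE index types read inside one index type through injective partial pull-backs, with a vanishing
   unmatched mass [folklore].
§2 the torus/lattice dictionary for localization domains [folklore]: a torus domain X̄ ⊂ (ℤ/N)^d all of whose cubes lie
   in the centred box of radius R, 2R + 3 ≤ N, lifts by minimal representatives (`B12Decay510Torus.vmaVec`) to a lattice
   localization domain of ℤ^d (face-connected: `faceConnected_image_vmaVec`) with the same number of cubes
   (`card_liftDom`) and with dist(0, ·) not increased (`dL_liftDom_le`); a lattice domain in the box is the lift of its
   reduction mod N (`liftDom_tproj`); a torus domain NOT in the box has dist(0, X̄) + d_j(X̄) > R − 2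
   (`sub_lt_dist_add_treeLen`).
§3 the summable majorant `major` = 4A_rem α₂⁻²B₃² e^{κ₀} · e^{−a₀(2d)|Y|} e^{−δ₀ dist(0,Y)}` on the lattice localization
   domains of ℤ^d (`summable_major`: windows, `B12TreeDecay.sum_exp_vol_le`, `B12Decay510Lattice.cubeSumLeafL`).
§4 `PolLeavesTLoc` = `PolLeavesT` with the field `hlim` REPLACED by the termwise clause `hloc` (below), the limit kernel no
   longer a datum but DEFINED, `limKernel a z := Σ'_Y a Y z`; the per-torus kernel bound from the chain's OWN leaves
   (`PolLeavesTLoc.kernelBound`: the (1.18)-leaf DERIVED from Lemma 3 via `RemainderChainKP.h118_linear_of_KP`, (4.35) +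
   the Cauchy estimate `B12Decay510.qBound_of_analytic`, the p. 282 decay); the domination of the non-wrapping terms by
   `major ∘ liftDom` (`abs_term_le_major`, via `B12TreeDecay.exp_tree_le_exp_vol` on `TreeLengthTorus.tvolumeLeaf`) and
   the vanishing of the wrapping mass (`tendsto_bad_mass`, via `B12Decay510.weight_sum_le` on `cubeSumLeafT`, `treeLeafT`);
   `PolLeavesTLoc.tendsto_sum` = (5.1) PROVED: `Σ_{X̄ ∈ 𝐃(T_n)} 𝐄^{(2)}_n(X̄, 0, z) → Σ'_Y a Y z`, the limit kernel
   summable and termwise dominated; `PolLeavesTLoc.toPolLeavesT : PolLeavesT d M (limKernel a) c ℓ α₂ B₃`.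
§5 `ChainTLoc` (the chain with `PolLeavesTLoc` leaves; the (1.22) dictionary clause reads the DEFINED kernel),
   `ChainTLoc.toChainT` and `ChainTLoc.abs_beta1_le : … → RemainderConst S γ (c.ε₁ * remCoeffL d M c α₂ B₃)` — LITERALLY
   the conclusion of `ChainT.abs_beta1_le`, same closed-form coefficient; the RULING (R10) END consumers by name.

THE RESIDUAL (located, honest).  `hloc : ∀ Y z, E2n n (Y mod N_n) (0 mod N_nM) (z mod N_nM) → a Y z`: for each FIXED
lattice localization domain Y ⊂ ℤ^d and each fixed z, the polarization TERM of the reduction of Y to the n-th torus,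
evaluated at the images of 0 and z, converges as n → ∞.  This is the term-level content of the printed sentence p. 264
(the locality (1.7) of the term in the fields on Y, which for N_n large does not see the identification of the boundary)
— NOT proved here, carried as the displayed hypothesis field `hloc`.  Versus `PolLeavesT.hlim` (convergence of the full
SUMS over the n-dependent catalogues 𝐃(T_n) to SOME kernel P, P a datum) the interchange of limit and polymer sum, the
summability of the limit kernel and the identification P = Σ_Y a_Y are now theorems.

NOT touched: Lemma 3 / (2.38), (2.13), (4.4), (4.35), p. 282, (1.7) themselves (the other fields, carried verbatim);
nothing of (1.22) for Bałaban's actual β-functions is asserted; no existing declaration is modified (imports untouched).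
Value = one ASSERTED-in-print leaf of the (β) class converted into kernel analysis; NOT summit progress, NOT the
continuum limit, NOT Clay.  (Cell pub-balaban, β sub-cell, row BETA-an4 — the k-uniform remainder —, generation 11.)
-/

namespace Literature.MathematicalPhysics.QuantumFieldTheory.Balaban1983to89.Beta.RemainderLimitTorus

open Literature.MathematicalPhysics.QuantumFieldTheory.Balaban1983to89
open FlowStep DagBinding FlowStepRuns
open Literature.MathematicalPhysics.QuantumFieldTheory.Balaban1983to89.B13ScaleTransfer (Pt Adj Linked FaceConnected)
open Literature.MathematicalPhysics.QuantumFieldTheory.Balaban1983to89.B13Resummation (SpRestr Repr213)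
open Literature.MathematicalPhysics.QuantumFieldTheory.Balaban1983to89.B12TreeDecay
  (a₀ kappa₀ K₀ K₀_pos sum_exp_vol_le exp_tree_le_exp_vol)
open Literature.MathematicalPhysics.QuantumFieldTheory.Balaban1983to89.TreeLengthTorus
  (TPt TDom proj TAdj TLinked TFaceConnected tFaceConnected_image tsys tcubeSys torusTreeLen torusTreeLen_nonneg tsys_dj
    tcubeSys_vol tvolumeLeaf natLift)
open Literature.MathematicalPhysics.QuantumFieldTheory.Balaban1983to89.TreeLengthTorusGeometry (TorusStep)
open Literature.MathematicalPhysics.QuantumFieldTheory.Balaban1983to89.TreeLengthCubeSystem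
  (Dom cubeSys Cell cubeSys_vol degreeLE)
open Literature.MathematicalPhysics.QuantumFieldTheory.Balaban1983to89.B12Decay510
  (KernelBound kernelBound_of_repr435 qBound_of_analytic weight_sum_le sum_pick_le mixedDeriv)
open Literature.MathematicalPhysics.QuantumFieldTheory.Balaban1983to89.B12Decay510Window (K₁ K₁_nonneg l1_neg)
open Literature.MathematicalPhysics.QuantumFieldTheory.Balaban1983to89.B12Decay510Lattice
  (cubeOf distCube distCube_nonneg distCube_le_l1_sub nearL nearL_le geomL geomL_distC cubeSumLeafL)
open Literature.MathematicalPhysics.QuantumFieldTheory.Balaban1983to89.B12Decay510Torus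
  (pabs pabs_nonneg pabs_add_le exists_eq_add_mul_of_cast_eq valMinAbs_intCast_of_two_mul_abs_lt vmaVec
    vmaVec_injective proj_vmaVec pl1 pl1_eq_sum pl1_sub_comm tcubeOf proj_cubeOf_of_proj_eq distCT distCT_nonneg
    exists_distCT_eq pl1_tcubeOf_sub_le_distCT pabs_sub_le_torusTreeLen nearT nearT_mem geomT geomT_distD geomT_distC
    cubeSumLeafT treeLeafT)
open Literature.MathematicalPhysics.QuantumFieldTheory.Balaban1983to89.B12Sec2to5 (l1)
open Literature.MathematicalPhysics.QuantumFieldTheory.Balaban1983to89.Beta.RemainderChain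
open Literature.MathematicalPhysics.QuantumFieldTheory.Balaban1983to89.Beta.RemainderChainKP (h118_linear_of_KP)
open Literature.MathematicalPhysics.QuantumFieldTheory.Balaban1983to89.Beta.RemainderChainLattice
  (CondsL SignsL remCoeffL)
open Literature.MathematicalPhysics.QuantumFieldTheory.Balaban1983to89.Beta.RemainderChainTorus
  (PolLeavesT ChainT betaPartialSumsLowerH_of_telescope_chainT endpointExistence_of_telescope_chainT)
open Metric Filter Topology

noncomputable section

variable {d : ℕ}

/-! ## 1. Tannery's theorem over growing finite index types, read in one index type by injective partial pull-backs -/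

/-- **Dominated convergence for sums over a sequence of finite index types.**  Terms `t n : T n → ℝ` on finite types
`T n`; a "good" part `good n ⊂ T n` read INJECTIVELY inside one index type `J` by `ι n`, every index `Y : J` being, for
n large, the image of a good element `π n Y` at which the terms converge to `a Y`; the good terms dominated through `ι n`
by a summable `g ≥ 0`; the remaining ("bad", covering the complement of the good part) mass tending to zero.  THEN `a` is
summable, `|a| ≤ g`, and `Σ_{X : T n} t n X → Σ'_Y a Y` (Mathlib's Tannery theorem
`tendsto_tsum_of_dominated_convergence` applied to the pull-backs `Y ↦ Σ_{X good, ι X = Y} t n X`). [folklore] -/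
theorem tendsto_sum_of_dominated_pullback {J : Type*} {T : ℕ → Type*} [∀ n, Fintype (T n)]
    (t : (n : ℕ) → T n → ℝ) (good bad : (n : ℕ) → Finset (T n)) (ι : (n : ℕ) → T n → J)
    (π : (n : ℕ) → J → T n) (a g : J → ℝ)
    (hcover : ∀ n X, X ∉ good n → X ∈ bad n) (hinj : ∀ n, Set.InjOn (ι n) (good n))
    (hsec : ∀ Y, ∀ᶠ n in atTop, π n Y ∈ good n ∧ ι n (π n Y) = Y)
    (hlim : ∀ Y, Tendsto (fun n => t n (π n Y)) atTop (𝓝 (a Y)))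
    (hdom : ∀ n, ∀ X ∈ good n, |t n X| ≤ g (ι n X)) (hg : ∀ Y, 0 ≤ g Y) (hgs : Summable g)
    (hbad : Tendsto (fun n => ∑ X ∈ bad n, |t n X|) atTop (𝓝 0)) :
    Summable a ∧ (∀ Y, |a Y| ≤ g Y) ∧ Tendsto (fun n => ∑ X, t n X) atTop (𝓝 (∑' Y, a Y)) := by
  classical
  -- the pull-back of the n-th term function to `J` along `ι n` (zero off the image of the good part)
  set u : ℕ → J → ℝ := fun n Y => ∑ X ∈ (good n).filter (fun X => ι n X = Y), t n X with hu
  have hfib : ∀ n, ∀ X ∈ good n, (good n).filter (fun X' => ι n X' = ι n X) = {X} := by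
    intro n X hX
    ext X'
    simp only [Finset.mem_filter, Finset.mem_singleton]
    exact ⟨fun h => hinj n h.1 hX h.2, fun h => by subst h; exact ⟨hX, rfl⟩⟩
  have hu_good : ∀ n, ∀ X ∈ good n, u n (ι n X) = t n X := by
    intro n X hX
    simp only [hu]
    rw [hfib n X hX, Finset.sum_singleton]
  have hu_zero : ∀ n Y, Y ∉ (good n).image (ι n) → u n Y = 0 := by
    intro n Y hY
    simp only [hu]
    refine Finset.sum_eq_zero fun X hX => ?_
    exact absurd (Finset.mem_image.2 ⟨X, (Finset.mem_filter.1 hX).1, (Finset.mem_filter.1 hX).2⟩) hY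
  have hu_le : ∀ n Y, |u n Y| ≤ g Y := by
    intro n Y
    by_cases hY : Y ∈ (good n).image (ι n)
    · obtain ⟨X, hX, rfl⟩ := Finset.mem_image.1 hY
      rw [hu_good n X hX]
      exact hdom n X hX
    · rw [hu_zero n Y hY, abs_zero]
      exact hg Y
  have hu_lim : ∀ Y, Tendsto (fun n => u n Y) atTop (𝓝 (a Y)) := by
    intro Y
    refine (hlim Y).congr' ?_
    filter_upwards [hsec Y] with n hn
    have h := hu_good n (π n Y) hn.1
    rw [hn.2] at h
    exact h.symm
  have hsum_good : ∀ n, ∑ X ∈ good n, t n X = ∑' Y, u n Y := by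
    intro n
    rw [tsum_eq_sum (s := (good n).image (ι n)) (fun Y hY => hu_zero n Y hY)]
    rw [Finset.sum_image' (t n) (fun X _ => by simp only [hu])]
  have hT : Tendsto (fun n => ∑' Y, u n Y) atTop (𝓝 (∑' Y, a Y)) :=
    tendsto_tsum_of_dominated_convergence hgs hu_lim
      (Eventually.of_forall fun n Y => by rw [Real.norm_eq_abs]; exact hu_le n Y)
  have ha : ∀ Y, |a Y| ≤ g Y := fun Y =>
    le_of_tendsto ((hu_lim Y).abs) (Eventually.of_forall fun n => hu_le n Y)
  have hsa : Summable a := hgs.of_norm_bounded fun Y => by rw [Real.norm_eq_abs]; exact ha Y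
  refine ⟨hsa, ha, ?_⟩
  -- total = good part + the rest; the rest is dominated by the bad mass
  have hsplit : ∀ n, ∑ X, t n X = ∑' Y, u n Y + ∑ X ∈ (good n)ᶜ, t n X := by
    intro n
    rw [← hsum_good n, Finset.sum_add_sum_compl]
  have hrest : Tendsto (fun n => ∑ X ∈ (good n)ᶜ, t n X) atTop (𝓝 0) := by
    refine squeeze_zero_norm (fun n => ?_) hbad
    rw [Real.norm_eq_abs]
    refine (Finset.abs_sum_le_sum_abs _ _).trans ?_
    exact Finset.sum_le_sum_of_subset_of_nonneg (fun X hX => hcover n X (Finset.mem_compl.1 hX))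
      fun X _ _ => abs_nonneg _
  have h := hT.add hrest
  rw [add_zero] at h
  exact h.congr' (Eventually.of_forall fun n => (hsplit n).symm)

/-! ## 2. Torus localization domains in a centred box are lattice localization domains of ℤ^d -/

section Lift

variable {N : ℕ} [NeZero N]

omit [NeZero N] in
/-- A residue of ℤ/N that agrees with an integer x mod N, with ∣x∣ + ∣a∣_N < N, has minimal representative x. [folklore] -/
theorem valMinAbs_eq_of_abs_add_lt {a : ZMod N} {x : ℤ} (h : ((x : ℤ) : ZMod N) = a) (hx : |x| + pabs a < N) :
    a.valMinAbs = x := by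
  have h1 : ((a.valMinAbs : ℤ) : ZMod N) = ((x : ℤ) : ZMod N) := by rw [ZMod.coe_valMinAbs, h]
  obtain ⟨j, hj⟩ := exists_eq_add_mul_of_cast_eq h1
  have h2 : (N : ℤ) ∣ x - a.valMinAbs := ⟨j, by rw [hj]; ring⟩
  have h3 : |x - a.valMinAbs| < N := by
    unfold pabs at hx
    have e1 := le_abs_self x
    have e2 := neg_abs_le x
    have e3 := le_abs_self a.valMinAbs
    have e4 := neg_abs_le a.valMinAbs
    rw [abs_lt]
    constructor <;> linarith
  have h4 := Int.eq_zero_of_abs_lt_dvd h2 h3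
  linarith

/-- X̄ lies in the centred box of radius R: every cube index of X̄ has all its periodic coordinates ∣·∣_N ≤ R. [folklore] -/
def Small (R : ℕ) (X : Finset (TPt d N)) : Prop := ∀ c ∈ X, ∀ i, pabs (c i) ≤ R

omit [NeZero N] in
/-- In the box (2R + 3 ≤ N), the minimal representatives commute with the step c ↦ c + e_i. [folklore] -/
theorem vmaVec_update {R : ℕ} (hN : 2 * R + 3 ≤ N) {a b : TPt d N} (ha : ∀ i, pabs (a i) ≤ R)
    (hb : ∀ i, pabs (b i) ≤ R) {i : Fin d} (h : b = Function.update a i (a i + 1)) :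
    vmaVec b = Function.update (vmaVec a) i (vmaVec a i + 1) := by
  funext j
  by_cases hj : j = i
  · subst hj
    rw [Function.update_self]
    have hbj : b j = a j + 1 := by rw [h, Function.update_self]
    show (b j).valMinAbs = (a j).valMinAbs + 1
    apply valMinAbs_eq_of_abs_add_lt
    · rw [hbj, Int.cast_add, Int.cast_one, ZMod.coe_valMinAbs]
    · have h1 := ha j
      have h2 := hb j
      unfold pabs at h1 h2 ⊢
      have e1 := le_abs_self (a j).valMinAbs
      have e2 := neg_abs_le (a j).valMinAbs
      have h3 : |(a j).valMinAbs + 1| ≤ |(a j).valMinAbs| + 1 := by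
        rw [abs_le]; constructor <;> linarith
      have hN' : (2 * R + 3 : ℤ) ≤ N := by exact_mod_cast hN
      linarith
  · rw [Function.update_of_ne hj, h]
    show (Function.update a i (a i + 1) j).valMinAbs = (a j).valMinAbs
    rw [Function.update_of_ne hj]

omit [NeZero N] in
/-- In the box, torus wall adjacency lifts to lattice wall adjacency of the minimal representatives. [folklore] -/
theorem adj_vmaVec {R : ℕ} (hN : 2 * R + 3 ≤ N) {a b : TPt d N} (ha : ∀ i, pabs (a i) ≤ R)
    (hb : ∀ i, pabs (b i) ≤ R) (h : TAdj a b) : Adj (vmaVec a) (vmaVec b) := by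
  obtain ⟨i, h | h⟩ := h
  · exact ⟨i, Or.inl (vmaVec_update hN ha hb h)⟩
  · exact ⟨i, Or.inr (vmaVec_update hN hb ha h)⟩

omit [NeZero N] in
/-- In the box, a torus-face-connected family lifts to a face-connected family of ℤ^d. [folklore] -/
theorem faceConnected_image_vmaVec {R : ℕ} (hN : 2 * R + 3 ≤ N) {X : Finset (TPt d N)} (hs : Small R X)
    (hc : TFaceConnected X) : FaceConnected (X.image vmaVec) := by
  intro x hx y hy
  obtain ⟨a, ha, rfl⟩ := Finset.mem_image.1 hx
  obtain ⟨b, hb, rfl⟩ := Finset.mem_image.1 hy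
  have key : ∀ b', Relation.ReflTransGen (TreeLengthTorus.TStepIn X) a b' →
      Relation.ReflTransGen (B13ScaleTransfer.StepIn (X.image vmaVec)) (vmaVec a) (vmaVec b') := by
    intro b' h
    induction h with
    | refl => exact Relation.ReflTransGen.refl
    | tail _ hbc ih =>
      exact ih.tail ⟨Finset.mem_image_of_mem _ hbc.1, Finset.mem_image_of_mem _ hbc.2.1,
        adj_vmaVec hN (hs _ hbc.1) (hs _ hbc.2.1) hbc.2.2⟩
  exact key b (hc a ha b hb)

/-- The reduction of the site 0 is the site 0. [folklore] -/
theorem proj_zero (T : ℕ) : proj T (0 : Pt d) = 0 := by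
  funext i
  simp [proj]

/-- A lattice point with all ∣coordinates∣ ≤ R (2R + 3 ≤ N) is the minimal representative of its reduction. [folklore] -/
theorem vmaVec_proj_of_abs_le {R : ℕ} (hN : 2 * R + 3 ≤ N) {y : Pt d} (hy : ∀ i, |y i| ≤ R) :
    vmaVec (proj N y) = y := by
  funext i
  show (((y i : ℤ) : ZMod N)).valMinAbs = y i
  have hN' : (2 * R + 3 : ℤ) ≤ N := by exact_mod_cast hN
  have := hy i
  exact valMinAbs_intCast_of_two_mul_abs_lt (by linarith)

/-- … and its reduction lies in the box. [folklore] -/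
theorem pabs_proj_le {R : ℕ} (hN : 2 * R + 3 ≤ N) {y : Pt d} (hy : ∀ i, |y i| ≤ R) (i : Fin d) :
    pabs (proj N y i) ≤ R := by
  have h := congrFun (vmaVec_proj_of_abs_le hN hy) i
  simp only [vmaVec] at h
  show |(proj N y i).valMinAbs| ≤ R
  rw [h]
  exact hy i

variable {M : ℕ} [NeZero M]

/-- The cube of the site 0 is the cube 0. [folklore] -/
theorem tcubeOf_zero : tcubeOf N M (0 : TPt d (N * M)) = 0 := by
  funext i
  simp [B12Decay510Torus.tcubeOf, TreeLengthTorus.natLift, B12Decay510Lattice.cubeOf, proj]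

/-- In the box, taking the cube commutes with taking minimal representatives: ⌊ṽ/M⌋ = (cube of v)~ for a site v whose cube
lies in the box (ṽ ∈ ]−NM/2, NM/2]^d the minimal representative). [folklore] -/
theorem cubeOf_vmaVec {R : ℕ} (hN : 2 * R + 3 ≤ N) (q : TPt d (N * M)) (hc : ∀ i, pabs (tcubeOf N M q i) ≤ R) :
    cubeOf M (vmaVec q) = vmaVec (tcubeOf N M q) := by
  have hM : (0 : ℤ) < M := by exact_mod_cast Nat.pos_of_neZero M
  have hproj : proj N (cubeOf M (vmaVec q)) = tcubeOf N M q := proj_cubeOf_of_proj_eq (proj_vmaVec q)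
  funext i
  have hi : (((cubeOf M (vmaVec q)) i : ℤ) : ZMod N) = tcubeOf N M q i := by
    rw [← hproj]
    rfl
  symm
  apply valMinAbs_eq_of_abs_add_lt hi
  show |(q i).valMinAbs / (M : ℤ)| + pabs (tcubeOf N M q i) < N
  set v : ℤ := (q i).valMinAbs with hv
  have h1 : (M : ℤ) * (v / M) ≤ v := Int.mul_ediv_self_le hM.ne'
  have h2 : v < (M : ℤ) * (v / M) + M := Int.lt_mul_ediv_self_add hM
  have h3 : 2 * |v| ≤ (N : ℤ) * M := by
    have h := ZMod.natAbs_valMinAbs_le (q i)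
    have h' : ((v.natAbs : ℕ) : ℤ) ≤ ((N * M / 2 : ℕ) : ℤ) := by exact_mod_cast h
    rw [Int.natCast_natAbs] at h'
    have h'' : ((N * M / 2 : ℕ) : ℤ) * 2 ≤ ((N * M : ℕ) : ℤ) := by exact_mod_cast Nat.div_mul_le_self (N * M) 2
    push_cast at h''
    linarith
  have e1 := le_abs_self v
  have e2 := neg_abs_le v
  have h4 : 2 * (v / (M : ℤ)) ≤ N := by nlinarith
  have h5 : -((N : ℤ) + 2) ≤ 2 * (v / (M : ℤ)) := by nlinarith
  have h6 := hc i
  have hN' : (2 * R + 3 : ℤ) ≤ N := by exact_mod_cast hN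
  by_cases ht : 0 ≤ v / (M : ℤ)
  · rw [abs_of_nonneg ht]
    linarith
  · rw [abs_of_neg (not_le.mp ht)]
    linarith

/-- In the box, dist(0, □_c) on the torus dominates the lattice ℓ¹ distance from 0 to the lifted cube c̃. [folklore] -/
theorem distCube_vmaVec_le_distCT {R : ℕ} (hN : 2 * R + 3 ≤ N) {c : TPt d N} (hc : ∀ i, pabs (c i) ≤ R) :
    distCube M 0 (vmaVec c) ≤ distCT N M 0 c := by
  have hM : 0 < M := Nat.pos_of_neZero M
  obtain ⟨q, hq, h⟩ := exists_distCT_eq (N := N) (M := M) (0 : TPt d (N * M)) c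
  rw [← h, pl1_sub_comm, sub_zero]
  have hc' : ∀ i, pabs (tcubeOf N M q i) ≤ R := fun i => by rw [hq]; exact hc i
  have hcube : cubeOf M (vmaVec q) = vmaVec c := by rw [← hq]; exact cubeOf_vmaVec hN q hc'
  calc distCube M 0 (vmaVec c) ≤ l1 (0 - vmaVec q) := distCube_le_l1_sub hM hcube 0
    _ = pl1 q := by rw [zero_sub, l1_neg]; rfl

/-- A torus domain NOT in the box of radius R reaches far: dist(0, X̄) + d_j(X̄) > R − 2 (a cube c of X̄ with a periodic
coordinate > R is within d_j(X̄) + 2 of the cube of X̄ nearest to 0, coordinatewise, `pabs_sub_le_torusTreeLen`). [folklore] -/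
theorem sub_lt_dist_add_treeLen {R : ℕ} (X : TDom d N) (h : ¬ Small R X.1) :
    (R : ℝ) - 2 < distCT N M 0 (nearT (M := M) 0 X) + torusTreeLen X.1 := by
  simp only [Small, not_forall, not_le] at h
  obtain ⟨c, hc, i, hi⟩ := h
  have hc₀ := nearT_mem (M := M) (0 : TPt d (N * M)) X
  have h1 : (pabs (c i - nearT (M := M) (0 : TPt d (N * M)) X i) : ℝ) ≤ torusTreeLen X.1 + 2 :=
    pabs_sub_le_torusTreeLen X.2.1 X.2.2 hc hc₀ i
  have h2 : pabs (c i) ≤ pabs (c i - nearT (M := M) (0 : TPt d (N * M)) X i) +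
      pabs (nearT (M := M) (0 : TPt d (N * M)) X i) := by
    have := pabs_add_le (c i - nearT (M := M) (0 : TPt d (N * M)) X i) (nearT (M := M) (0 : TPt d (N * M)) X i)
    rwa [sub_add_cancel] at this
  have h3 : (pabs (nearT (M := M) (0 : TPt d (N * M)) X i) : ℝ) ≤ pl1 (nearT (M := M) (0 : TPt d (N * M)) X) := by
    rw [pl1_eq_sum]
    exact Finset.single_le_sum (f := fun j => (pabs (nearT (M := M) (0 : TPt d (N * M)) X j) : ℝ))
      (fun j _ => by exact_mod_cast pabs_nonneg _) (Finset.mem_univ i)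
  have h4 : pl1 (nearT (M := M) (0 : TPt d (N * M)) X) ≤ distCT N M 0 (nearT (M := M) 0 X) := by
    have := pl1_tcubeOf_sub_le_distCT (N := N) (M := M) (0 : TPt d (N * M)) (nearT (M := M) 0 X)
    rwa [tcubeOf_zero, pl1_sub_comm, sub_zero] at this
  have h2' : (pabs (c i) : ℝ) ≤ (pabs (c i - nearT (M := M) (0 : TPt d (N * M)) X i) : ℝ) +
      (pabs (nearT (M := M) (0 : TPt d (N * M)) X i) : ℝ) := by exact_mod_cast h2
  have hi' : (R : ℝ) < (pabs (c i) : ℝ) := by exact_mod_cast hi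
  linarith

/-! ### Lattice localization domains of ℤ^d, reduction mod N, lift -/

/-- Y is a localization domain of ℤ^d: a non-empty face-connected family of cubes (no window). [cite: Balaban1987RG1, §0 p.257] -/
def IsLDom (Y : Finset (Pt d)) : Prop := Y.Nonempty ∧ FaceConnected Y

/-- The type 𝐃(ℤ^d) of localization domains of ℤ^d. [cite: Balaban1987RG1, §0 p.257] -/
def LDom (d : ℕ) : Type := {Y : Finset (Pt d) // IsLDom Y}

omit [NeZero N] in
/-- A single cube is face-connected. [folklore] -/
theorem faceConnected_singleton (x : Pt d) : FaceConnected ({x} : Finset (Pt d)) := by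
  intro a ha b hb
  rw [Finset.mem_singleton] at ha hb
  subst ha
  subst hb
  exact Relation.ReflTransGen.refl

/-- The reduction mod N of a localization domain of ℤ^d: a torus localization domain (`tFaceConnected_image`). [folklore] -/
def tproj (N : ℕ) [NeZero N] (Y : LDom d) : TDom d N :=
  ⟨Y.1.image (proj N), Y.2.1.image _, tFaceConnected_image Y.2.2⟩

/-- The cubes of the reduction are the reductions of the cubes. [folklore] -/
@[simp] theorem tproj_val (N : ℕ) [NeZero N] (Y : LDom d) : (tproj N Y).1 = Y.1.image (proj N) := rfl

/-- Y lies in the lattice box of radius R. [folklore] -/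
def InBox (R : ℕ) (Y : LDom d) : Prop := ∀ y ∈ Y.1, ∀ i, |y i| ≤ R

/-- The reduction of a domain in the box lies in the box. [folklore] -/
theorem small_tproj {R : ℕ} (hN : 2 * R + 3 ≤ N) {Y : LDom d} (hY : InBox R Y) : Small R (tproj N Y).1 := by
  intro c hc i
  rw [tproj_val, Finset.mem_image] at hc
  obtain ⟨y, hy, rfl⟩ := hc
  exact pabs_proj_le hN (hY y hy) i

/-- The minimal representatives of the reduction of a domain in the box give the domain back. [folklore] -/
theorem image_vmaVec_tproj {R : ℕ} (hN : 2 * R + 3 ≤ N) {Y : LDom d} (hY : InBox R Y) :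
    (tproj N Y).1.image vmaVec = Y.1 := by
  ext x
  simp only [tproj_val, Finset.mem_image]
  constructor
  · rintro ⟨c, ⟨y, hy, rfl⟩, rfl⟩
    rw [vmaVec_proj_of_abs_le hN (hY y hy)]
    exact hy
  · intro hx
    exact ⟨proj N x, ⟨x, hx, rfl⟩, vmaVec_proj_of_abs_le hN (hY x hx)⟩

open Classical in
/-- The lift of a torus localization domain by minimal representatives — a localization domain of ℤ^d when the torus
domain lies in the box (else a harmless default). [folklore] -/
def liftDom (X : TDom d N) : LDom d :=
  if h : IsLDom (X.1.image vmaVec) then ⟨_, h⟩ else ⟨{0}, Finset.singleton_nonempty 0, faceConnected_singleton 0⟩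

/-- In the box the lift is the family of minimal representatives. [folklore] -/
theorem liftDom_val {R : ℕ} (hN : 2 * R + 3 ≤ N) {X : TDom d N} (hs : Small R X.1) :
    (liftDom X).1 = X.1.image vmaVec := by
  have h : IsLDom (X.1.image vmaVec) := ⟨X.2.1.image _, faceConnected_image_vmaVec hN hs X.2.2⟩
  rw [liftDom, dif_pos h]

/-- In the box the lift has the same number of cubes. [folklore] -/
theorem card_liftDom {R : ℕ} (hN : 2 * R + 3 ≤ N) {X : TDom d N} (hs : Small R X.1) :
    (liftDom X).1.card = X.1.card := by
  rw [liftDom_val hN hs, Finset.card_image_of_injective _ vmaVec_injective]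

/-- In the box the lift is injective. [folklore] -/
theorem liftDom_injOn {R : ℕ} (hN : 2 * R + 3 ≤ N) {X X' : TDom d N} (hs : Small R X.1) (hs' : Small R X'.1)
    (h : liftDom X = liftDom X') : X = X' := by
  have h1 := congrArg Subtype.val h
  rw [liftDom_val hN hs, liftDom_val hN hs'] at h1
  exact Subtype.ext (Finset.image_injective vmaVec_injective h1)

/-- A domain in the box is the lift of its reduction. [folklore] -/
theorem liftDom_tproj {R : ℕ} (hN : 2 * R + 3 ≤ N) {Y : LDom d} (hY : InBox R Y) : liftDom (tproj N Y) = Y :=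
  Subtype.ext (by rw [liftDom_val hN (small_tproj hN hY), image_vmaVec_tproj hN hY])

omit [NeZero N] in
/-- dist(0, Y) on ℤ^d: the minimum over the cubes of Y of the ℓ¹ distance from the site 0 to the cube of side M. [folklore] -/
def dL (M : ℕ) (Y : LDom d) : ℝ := Y.1.inf' Y.2.1 fun y => distCube M 0 y

omit [NeZero N] [NeZero M] in
/-- dist(0, Y) ≥ 0. [folklore] -/
theorem dL_nonneg (Y : LDom d) : 0 ≤ dL M Y := by
  obtain ⟨y, -, h⟩ := Finset.exists_mem_eq_inf' Y.2.1 (fun y => distCube M 0 y)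
  rw [dL, h]
  exact distCube_nonneg _ _ _

omit [NeZero N] [NeZero M] in
/-- dist(0, Y) ≤ dist(0, □) for every cube of Y. [folklore] -/
theorem dL_le {Y : LDom d} {y : Pt d} (hy : y ∈ Y.1) : dL M Y ≤ distCube M 0 y :=
  Finset.inf'_le _ hy

/-- In the box, the torus distance dist(0, X̄) dominates the lattice distance dist(0, lift of X̄). [folklore] -/
theorem dL_liftDom_le {R : ℕ} (hN : 2 * R + 3 ≤ N) {X : TDom d N} (hs : Small R X.1) :
    dL M (liftDom X) ≤ distCT N M 0 (nearT (M := M) 0 X) := by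
  have hc₀ := nearT_mem (M := M) (0 : TPt d (N * M)) X
  have hmem : vmaVec (nearT (M := M) (0 : TPt d (N * M)) X) ∈ (liftDom X).1 := by
    rw [liftDom_val hN hs]
    exact Finset.mem_image_of_mem _ hc₀
  exact (dL_le hmem).trans (distCube_vmaVec_le_distCT hN (hs _ hc₀))

end Lift

/-! ## 3. The summable majorant on 𝐃(ℤ^d) -/

section Majorant

variable {M : ℕ} [NeZero M]

/-- THE MAJORANT `g(Y) = 4A_rem α₂⁻² B₃² e^{κ₀(4·2^d,2d)} · e^{−a₀(2d)|Y|} · e^{−δ₀ dist(0,Y)}` of the polarization terms,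
read on the lattice domains of ℤ^d. [folklore] -/
def major (d M : ℕ) (c : B13.Consts) (α₂ B₃ : ℝ) (Y : LDom d) : ℝ :=
  4 * remActivity c / α₂ ^ 2 * B₃ ^ 2 * Real.exp (kappa₀ (4 * 2 ^ d) (2 * d)) *
    (Real.exp (-a₀ (2 * d) * (Y.1.card : ℝ)) * Real.exp (-c.δ₀ * dL M Y))

omit [NeZero M] in
/-- The majorant is non-negative (A_rem ≥ 0). [folklore] -/
theorem major_nonneg {c : B13.Consts} {α₂ B₃ : ℝ} (hA : 0 ≤ remActivity c) (Y : LDom d) :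
    0 ≤ major d M c α₂ B₃ Y := by
  unfold major
  have : 0 ≤ 4 * remActivity c / α₂ ^ 2 := div_nonneg (by linarith) (sq_nonneg _)
  positivity

omit [NeZero M] in
/-- **The window estimate**: Σ_{Y ∈ 𝐃(B)} e^{−a₀(2d)|Y|} e^{−δ dist(0, □(0,Y))} ≤ K₁(d, δ)·(2d+1)^{−2} for every window B
(regroup by the nearest cube `B12Decay510.sum_pick_le`, the animal sum `B12TreeDecay.sum_exp_vol_le` at a₀ on the degree
bound `TreeLengthCubeSystem.degreeLE`, the cube sum `B12Decay510Lattice.cubeSumLeafL`). [folklore] -/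
theorem sum_dom_le (B : Finset (Pt d)) (hM : 0 < M) {δ : ℝ} (hδ : 0 < δ) :
    ∑ Y : Dom B, Real.exp (-a₀ (2 * d) * (Y.1.card : ℝ)) * Real.exp (-δ * distCube M 0 (nearL M B 0 Y)) ≤
      K₁ d δ * (1 / (((2 * d : ℕ) : ℝ) + 1) ^ 2) := by
  have h1 := sum_pick_le (geomL B M) (fun Y => Real.exp (-a₀ (2 * d) * ((Y : Dom B).1.card : ℝ)))
    (fun Y => (Real.exp_pos _).le) (fun c => Real.exp (-δ * distCube M 0 c.1)) (fun c => (Real.exp_pos _).le) 0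
  have h2 : ∀ c : Cell B, ∑ X ∈ (cubeSys B).toCubeCover.above c,
      Real.exp (-a₀ (2 * d) * ((X : Dom B).1.card : ℝ)) ≤ 1 / (((2 * d : ℕ) : ℝ) + 1) ^ 2 := by
    intro c
    have h := sum_exp_vol_le (cubeSys B) (degreeLE B) (le_refl (a₀ (2 * d))) c
    refine le_of_eq_of_le (Finset.sum_congr rfl fun X _ => ?_) h
    rw [cubeSys_vol]
  have h3 := cubeSumLeafL B hM hδ 0
  simp only [geomL_distC] at h3
  calc ∑ Y : Dom B, Real.exp (-a₀ (2 * d) * (Y.1.card : ℝ)) * Real.exp (-δ * distCube M 0 (nearL M B 0 Y))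
      ≤ ∑ c : Cell B, Real.exp (-δ * distCube M 0 c.1) *
          ∑ X ∈ (cubeSys B).toCubeCover.above c, Real.exp (-a₀ (2 * d) * ((X : Dom B).1.card : ℝ)) := h1
    _ ≤ ∑ c : Cell B, Real.exp (-δ * distCube M 0 c.1) * (1 / (((2 * d : ℕ) : ℝ) + 1) ^ 2) :=
        Finset.sum_le_sum fun c _ => mul_le_mul_of_nonneg_left (h2 c) (Real.exp_pos _).le
    _ ≤ K₁ d δ * (1 / (((2 * d : ℕ) : ℝ) + 1) ^ 2) := by
        rw [← Finset.sum_mul]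
        exact mul_le_mul_of_nonneg_right h3 (by positivity)

omit [NeZero M] in
/-- **Summability of the weights on 𝐃(ℤ^d)**: Σ_{Y ∈ 𝐃(ℤ^d)} e^{−a₀(2d)|Y|} e^{−δ dist(0,Y)} < ∞ (every finite partial sum
lives in a window and is bounded by the window estimate). [folklore] -/
theorem summable_weight (hM : 0 < M) {δ : ℝ} (hδ : 0 < δ) :
    Summable fun Y : LDom d => Real.exp (-a₀ (2 * d) * (Y.1.card : ℝ)) * Real.exp (-δ * dL M Y) := by
  classical
  refine summable_of_sum_le (fun Y => by positivity) (c := K₁ d δ * (1 / (((2 * d : ℕ) : ℝ) + 1) ^ 2)) fun F => ?_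
  -- the window containing every domain of F
  set B : Finset (Pt d) := F.biUnion fun Y => Y.1 with hB
  let e : {Y // Y ∈ F} → Dom B := fun Y =>
    ⟨Y.1.1, Finset.subset_biUnion_of_mem (fun Y : LDom d => Y.1) Y.2, Y.1.2.1, Y.1.2.2⟩
  have he : Function.Injective e := by
    intro Y Y' h
    have h1 : Y.1.1 = Y'.1.1 := by
      have h' := congrArg Subtype.val h
      exact h'
    exact Subtype.ext (Subtype.ext h1)
  calc ∑ Y ∈ F, Real.exp (-a₀ (2 * d) * (Y.1.card : ℝ)) * Real.exp (-δ * dL M Y)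
      = ∑ Y : {Y // Y ∈ F}, Real.exp (-a₀ (2 * d) * (Y.1.1.card : ℝ)) * Real.exp (-δ * dL M Y.1) :=
        (Finset.sum_coe_sort F _).symm
    _ ≤ ∑ Y : {Y // Y ∈ F}, Real.exp (-a₀ (2 * d) * ((e Y).1.card : ℝ)) *
          Real.exp (-δ * distCube M 0 (nearL M B 0 (e Y))) := by
        refine Finset.sum_le_sum fun Y _ => mul_le_mul_of_nonneg_left ?_ (Real.exp_pos _).le
        refine Real.exp_le_exp.2 (mul_le_mul_of_nonpos_left ?_ (by linarith))
        obtain ⟨y, hy, h⟩ := Finset.exists_mem_eq_inf' Y.1.2.1 (fun y => distCube M 0 y)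
        rw [dL, h]
        exact nearL_le M B 0 (e Y) hy
    _ = ∑ Y' ∈ (Finset.univ : Finset {Y // Y ∈ F}).image e,
          Real.exp (-a₀ (2 * d) * (Y'.1.card : ℝ)) * Real.exp (-δ * distCube M 0 (nearL M B 0 Y')) := by
        rw [Finset.sum_image fun Y _ Y' _ h => he h]
    _ ≤ ∑ Y' : Dom B, Real.exp (-a₀ (2 * d) * (Y'.1.card : ℝ)) * Real.exp (-δ * distCube M 0 (nearL M B 0 Y')) :=
        Finset.sum_le_sum_of_subset_of_nonneg (Finset.subset_univ _) fun _ _ _ => by positivity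
    _ ≤ K₁ d δ * (1 / (((2 * d : ℕ) : ℝ) + 1) ^ 2) := sum_dom_le B hM hδ

/-- **The majorant is summable on 𝐃(ℤ^d).** [folklore] -/
theorem summable_major {c : B13.Consts} {α₂ B₃ : ℝ} (hδ₀ : 0 < c.δ₀) : Summable (major d M c α₂ B₃) := by
  unfold major
  exact (summable_weight (Nat.pos_of_neZero M) hδ₀).mul_left _

end Majorant

/-! ## 4. The torus leaf list with (5.1) replaced by termwise locality; (5.1) PROVED -/

/-- **THE LIMIT KERNEL, DEFINED**: Π(z) := Σ'_{Y ∈ 𝐃(ℤ^d)} a_Y(z), the sum of the infinite-volume localized polarization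
terms ((4.37) read in the limit (5.1)). [cite: Balaban1987RG1, (4.37) p.291 and (5.1) p.292] -/
def limKernel (a : LDom d → Pt d → ℝ) (z : Pt d) : ℝ := ∑' Y, a Y z

/-- **THE TORUS LEAF LIST WITH THE LIMIT (5.1) REPLACED BY TERMWISE LOCALITY** — `RemainderChainTorus.PolLeavesT` verbatim
(the exhausting tori with `N n` cubes per direction, `N n → ∞`; the [II]-side step data with the torus catalogues and tree
length, (2.13), Lemma 3's (2.38)_ℓ; the (4.4) seam; analyticity on the α₂-ball, (4.35) `hrepr`, the p. 282 decay `hh` in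
the periodic ℓ¹ distance) EXCEPT its last field: instead of `hlim` (convergence of the SUMS Σ_{X̄∈𝐃(T_n)} 𝐄^{(2)}_n(X̄, 0, z)
to a given kernel P) the field `hloc` — for each FIXED localization domain Y of ℤ^d and each z ∈ ℤ^d the TERM of the
reduction Y mod N_n at the sites 0, z mod N_nM converges, to `a Y z` (the term-level content of p. 264 *"This limit exists
by the localized representation (1.7)"*; [Balaban1984PropagatorsI] p. 36 *"relating G on the torus to G on the whole
lattice ηZ^d in the usual way"*).  A HYPOTHESIS structure: nothing of it is discharged here; the limit kernel is no datum
of it (`limKernel a`). [cite: Balaban1987RG1, (1.21) p.264, (4.35) p.290 and (5.1) p.292; Balaban1988RG2Cluster, (2.38) p.20 and (2.13) p.14] -/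
structure PolLeavesTLoc (d M : ℕ) [NeZero M] (a : LDom d → Pt d → ℝ) (c : B13.Consts) (ℓ α₂ B₃ : ℝ) where
  N : ℕ → ℕ
  [hN : ∀ n, NeZero (N n)]
  hNlim : Tendsto N atTop atTop
  W : (n : ℕ) → TorusStep d (N n)
  hsp : ∀ n, SpRestr (W n).toStepData (W n).geom
  hrep : ∀ n, Repr213 (W n).toStepData (W n).geom
  h238 : ∀ n, B13.Bound238With (W n).toStepData c ℓ
  Wn : ℕ → Type
  [instW : ∀ n, NormedAddCommGroup (Wn n)]
  [instWs : ∀ n, NormedSpace ℂ (Wn n)]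
  EXn : (n : ℕ) → TDom d (N n) → Wn n → ℂ
  emb : (n : ℕ) → TDom d (N n) → Wn n → (W n).Φ
  hemb : ∀ n X, ∀ v ∈ ball (0 : Wn n) α₂, emb n X v ∈ (W n).sp2 X
  hcomp : ∀ n X v, EXn n X v = (W n).Ek1 X (emb n X v)
  hn : (n : ℕ) → TDom d (N n) → TPt d (N n * M) → Wn n
  E2n : (n : ℕ) → TDom d (N n) → TPt d (N n * M) → TPt d (N n * M) → ℝ
  han : ∀ n X, AnalyticOnNhd ℂ (EXn n X) (ball 0 α₂)
  hrepr : ∀ n X x y, E2n n X x y = (mixedDeriv (EXn n X) (hn n X x) (hn n X y)).re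
  hh : ∀ n X x, ‖hn n X x‖ ≤ B₃ * Real.exp (-c.δ₀ * distCT (N n) M x (nearT (M := M) x X))
  hloc : ∀ (Y : LDom d) (z : Pt d),
    Tendsto (fun n => E2n n (tproj (N n) Y) (proj (N n * M) 0) (proj (N n * M) z)) atTop (𝓝 (a Y z))

/-- The carried `NeZero (N n)` witnesses, as instances keyed on the leaf list. [folklore] -/
instance PolLeavesTLoc.instNeZeroN {d M : ℕ} [NeZero M] {a : LDom d → Pt d → ℝ} {c : B13.Consts} {ℓ α₂ B₃ : ℝ}
    (Lv : PolLeavesTLoc d M a c ℓ α₂ B₃) (n : ℕ) : NeZero (Lv.N n) := Lv.hN n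

/-- The carried normed-group structures of the test-vector spaces, as instances keyed on the leaf list. [folklore] -/
instance PolLeavesTLoc.instNormedAddCommGroupWn {d M : ℕ} [NeZero M] {a : LDom d → Pt d → ℝ} {c : B13.Consts}
    {ℓ α₂ B₃ : ℝ} (Lv : PolLeavesTLoc d M a c ℓ α₂ B₃) (n : ℕ) : NormedAddCommGroup (Lv.Wn n) := Lv.instW n

/-- The carried ℂ-normed-space structures of the test-vector spaces, as instances keyed on the leaf list. [folklore] -/
instance PolLeavesTLoc.instNormedSpaceWn {d M : ℕ} [NeZero M] {a : LDom d → Pt d → ℝ} {c : B13.Consts}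
    {ℓ α₂ B₃ : ℝ} (Lv : PolLeavesTLoc d M a c ℓ α₂ B₃) (n : ℕ) : NormedSpace ℂ (Lv.Wn n) := Lv.instWs n

section Leaves

variable {M : ℕ} [NeZero M] {a : LDom d → Pt d → ℝ} {c : B13.Consts} {ℓ α₂ B₃ : ℝ}
  (Lv : PolLeavesTLoc d M a c ℓ α₂ B₃)

/-- **The (I.1.18)-leaf DERIVED on torus n** (as `PolLeavesT.h118`: `RemainderChainKP.h118_linear_of_KP` at the constructed
torus geometry): `‖E^{(k+1)}(X̄, emb v)‖ ≤ A_rem e^{−κ·d_{k+1}(X̄)}` on the α₂-ball. [cite: Balaban1988RG2Cluster, (2.38) p.20 and (2.41) p.21] -/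
theorem PolLeavesTLoc.h118 (hC : CondsL d c ℓ) (h22 : c.R22gen ℓ) (hA : 0 ≤ c.C3act * c.ε₁) (n : ℕ) :
    ∀ X, ∀ v ∈ ball (0 : Lv.Wn n) α₂, ‖Lv.EXn n X v‖ ≤ remActivity c * Real.exp (-c.κ * torusTreeLen X.1) :=
  h118_linear_of_KP (Lv.W n).toStepData c ℓ (Lv.W n).geom (Lv.hsp n) (Lv.hrep n) (Lv.h238 n) h22 hA
    hC.kappa_pos.le hC.large hC.small hC.A₂ (Lv.emb n) (Lv.EXn n) (Lv.hemb n) (Lv.hcomp n)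

/-- **The two-sided kernel bound on torus n from the chain's own leaves** (`B12Decay510.kernelBound_of_repr435` on (4.35),
the Cauchy estimate `qBound_of_analytic` from the derived (1.18)-leaf, and the p. 282 decay): ∣𝐄^{(2)}_n(X̄, x, y)∣ ≤
4A_rem α₂⁻² B₃² e^{−κ d_j(X̄)} e^{−δ₀ dist(x, X̄)} e^{−δ₀ dist(y, X̄)}. [cite: Balaban1987RG1, (4.35) p.290 and (4.5) p.282] -/
theorem PolLeavesTLoc.kernelBound (hC : CondsL d c ℓ) (h22 : c.R22gen ℓ) (hs : SignsL c α₂ B₃) (n : ℕ) :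
    KernelBound (geomT d (Lv.N n) M) (Lv.E2n n) (4 * remActivity c / α₂ ^ 2 * B₃ ^ 2) c.κ c.δ₀ :=
  kernelBound_of_repr435 (S := tsys d (Lv.N n)) (geomT d (Lv.N n) M) (V := fun _ => Lv.Wn n)
    (fun X u v => (mixedDeriv (Lv.EXn n X) u v).re) (Lv.hn n) (Lv.E2n n)
    (div_nonneg (mul_nonneg (by norm_num) (hC.remActivity_nonneg hs.A)) (sq_nonneg _)) hs.B₃_nonneg (Lv.hrepr n)
    (qBound_of_analytic (S := tsys d (Lv.N n)) (Lv.EXn n) hs.α₂_pos (Lv.han n) (Lv.h118 hC h22 hs.A n)) (Lv.hh n)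

/-- One distance factor dropped: ∣𝐄^{(2)}_n(X̄, x, y)∣ ≤ 4A_rem α₂⁻² B₃² e^{−κ d_j(X̄)} e^{−δ₀ dist(x, X̄)}. [folklore] -/
theorem PolLeavesTLoc.abs_term_le (hC : CondsL d c ℓ) (h22 : c.R22gen ℓ) (hs : SignsL c α₂ B₃) (n : ℕ)
    (X : TDom d (Lv.N n)) (x y : TPt d (Lv.N n * M)) :
    |Lv.E2n n X x y| ≤ 4 * remActivity c / α₂ ^ 2 * B₃ ^ 2 * Real.exp (-c.κ * torusTreeLen X.1) *
      Real.exp (-c.δ₀ * distCT (Lv.N n) M x (nearT (M := M) x X)) := by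
  have h := Lv.kernelBound hC h22 hs n X x y
  simp only [geomT_distD, tsys_dj] at h
  have hD := distCT_nonneg (N := Lv.N n) (M := M) y (nearT (M := M) y X)
  have hδ := hs.δ₀_pos
  have h1 : Real.exp (-c.δ₀ * distCT (Lv.N n) M y (nearT (M := M) y X)) ≤ 1 :=
    Real.exp_le_one_iff.2 (by nlinarith)
  have hA : 0 ≤ 4 * remActivity c / α₂ ^ 2 := div_nonneg (by linarith [hC.remActivity_nonneg hs.A]) (sq_nonneg _)
  have h0 : 0 ≤ 4 * remActivity c / α₂ ^ 2 * B₃ ^ 2 * Real.exp (-c.κ * torusTreeLen X.1) *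
      Real.exp (-c.δ₀ * distCT (Lv.N n) M x (nearT (M := M) x X)) := by positivity
  calc |Lv.E2n n X x y| ≤ _ := h
    _ ≤ 4 * remActivity c / α₂ ^ 2 * B₃ ^ 2 * Real.exp (-c.κ * torusTreeLen X.1) *
      Real.exp (-c.δ₀ * distCT (Lv.N n) M x (nearT (M := M) x X)) * 1 := mul_le_mul_of_nonneg_left h1 h0
    _ = _ := mul_one _

/-- The radius of the box at step n: R_n := ⌊(N_n − 3)/2⌋, so that 2R_n + 3 ≤ N_n once N_n ≥ 3, and R_n → ∞. [folklore] -/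
def PolLeavesTLoc.rad (n : ℕ) : ℕ := (Lv.N n - 3) / 2

/-- 2R_n + 3 ≤ N_n once N_n ≥ 3. [folklore] -/
theorem PolLeavesTLoc.rad_spec {n : ℕ} (hn : 3 ≤ Lv.N n) : 2 * Lv.rad n + 3 ≤ Lv.N n := by
  unfold PolLeavesTLoc.rad
  omega

/-- **Domination of the non-wrapping terms**: for X̄ in the box of radius R_n, ∣𝐄^{(2)}_n(X̄, 0, y)∣ ≤ g(lift of X̄)
(tree length → volume by `B12TreeDecay.exp_tree_le_exp_vol` on `TreeLengthTorus.tvolumeLeaf`, |lift| = |X̄|,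
dist(0, lift) ≤ dist(0, X̄)). [folklore] -/
theorem PolLeavesTLoc.abs_term_le_major (hC : CondsL d c ℓ) (h22 : c.R22gen ℓ) (hs : SignsL c α₂ B₃) {n : ℕ}
    (hn : 3 ≤ Lv.N n) {X : TDom d (Lv.N n)} (hX : Small (Lv.rad n) X.1) (y : TPt d (Lv.N n * M)) :
    |Lv.E2n n X 0 y| ≤ major d M c α₂ B₃ (liftDom X) := by
  have hN := Lv.rad_spec hn
  have h := Lv.abs_term_le hC h22 hs n X 0 y
  have hA : 0 ≤ 4 * remActivity c / α₂ ^ 2 := div_nonneg (by linarith [hC.remActivity_nonneg hs.A]) (sq_nonneg _)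
  have hC0 : 0 ≤ 4 * remActivity c / α₂ ^ 2 * B₃ ^ 2 := mul_nonneg hA (sq_nonneg _)
  have hv : Real.exp (-c.κ * torusTreeLen X.1) ≤
      Real.exp (kappa₀ (4 * 2 ^ d) (2 * d)) * Real.exp (-a₀ (2 * d) * (X.1.card : ℝ)) := by
    have := exp_tree_le_exp_vol (tcubeSys d (Lv.N n)) (tvolumeLeaf d (Lv.N n)) (κ := c.κ) (Δ := 2 * d)
      (by linarith [hC.tree, hC.kappa_pos]) X
    rwa [tsys_dj, tcubeSys_vol] at this
  have hD : Real.exp (-c.δ₀ * distCT (Lv.N n) M 0 (nearT (M := M) 0 X)) ≤ Real.exp (-c.δ₀ * dL M (liftDom X)) :=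
    Real.exp_le_exp.2 (by have := dL_liftDom_le (M := M) hN hX; nlinarith [hs.δ₀_pos])
  calc |Lv.E2n n X 0 y| ≤ _ := h
    _ ≤ 4 * remActivity c / α₂ ^ 2 * B₃ ^ 2 *
          (Real.exp (kappa₀ (4 * 2 ^ d) (2 * d)) * Real.exp (-a₀ (2 * d) * (X.1.card : ℝ))) *
          Real.exp (-c.δ₀ * dL M (liftDom X)) :=
        mul_le_mul (mul_le_mul_of_nonneg_left hv hC0) hD (Real.exp_pos _).le (mul_nonneg hC0 (by positivity))
    _ = major d M c α₂ B₃ (liftDom X) := by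
        rw [major, card_liftDom hN hX]
        ring

open Classical in
/-- The non-wrapping ("good") domains at step n: N_n ≥ 3 and all cubes in the box of radius R_n. [folklore] -/
def PolLeavesTLoc.good (n : ℕ) : Finset (TDom d (Lv.N n)) :=
  Finset.univ.filter fun X => 3 ≤ Lv.N n ∧ Small (Lv.rad n) X.1

open Classical in
/-- The remaining ("bad", wrapping or far) domains at step n. [folklore] -/
def PolLeavesTLoc.bad (n : ℕ) : Finset (TDom d (Lv.N n)) :=
  Finset.univ.filter fun X => ¬ (3 ≤ Lv.N n ∧ Small (Lv.rad n) X.1)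

/-- Membership in the good part, unfolded. [folklore] -/
theorem PolLeavesTLoc.mem_good {n : ℕ} {X : TDom d (Lv.N n)} :
    X ∈ Lv.good n ↔ 3 ≤ Lv.N n ∧ Small (Lv.rad n) X.1 := by
  classical
  simp [PolLeavesTLoc.good]

/-- Membership in the bad part, unfolded. [folklore] -/
theorem PolLeavesTLoc.mem_bad {n : ℕ} {X : TDom d (Lv.N n)} :
    X ∈ Lv.bad n ↔ ¬ (3 ≤ Lv.N n ∧ Small (Lv.rad n) X.1) := by
  classical
  simp [PolLeavesTLoc.bad]

/-- **The wrapping mass at step n**: Σ_{X̄ bad} ∣𝐄^{(2)}_n(X̄, 0, y)∣ ≤ 4A_rem α₂⁻² B₃² K₀ K₁(δ₀/2) · e^{−η(R_n − 2)},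
η = min{κ/2, δ₀/2} (a bad domain has dist(0, X̄) + d_j(X̄) > R_n − 2; half of each rate pays for it, the other half is
summed by `B12Decay510.weight_sum_le` on the torus leaves `cubeSumLeafT`, `treeLeafT`). [folklore] -/
theorem PolLeavesTLoc.bad_mass_le (hC : CondsL d c ℓ) (h22 : c.R22gen ℓ) (hs : SignsL c α₂ B₃) {n : ℕ}
    (hn : 3 ≤ Lv.N n) (y : TPt d (Lv.N n * M)) :
    ∑ X ∈ Lv.bad n, |Lv.E2n n X 0 y| ≤ 4 * remActivity c / α₂ ^ 2 * B₃ ^ 2 * K₀ (4 * 2 ^ d) (2 * d) *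
      K₁ d (c.δ₀ / 2) * Real.exp (-(min (c.κ / 2) (c.δ₀ / 2) * ((Lv.rad n : ℝ) - 2))) := by
  have hκ := hC.kappa_pos
  have hδ := hs.δ₀_pos
  have hη : 0 ≤ min (c.κ / 2) (c.δ₀ / 2) := le_min (by linarith) (by linarith)
  have hA : 0 ≤ 4 * remActivity c / α₂ ^ 2 := div_nonneg (by linarith [hC.remActivity_nonneg hs.A]) (sq_nonneg _)
  have hCE : 0 ≤ 4 * remActivity c / α₂ ^ 2 * B₃ ^ 2 := mul_nonneg hA (sq_nonneg _)
  -- termwise on the bad domains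
  have hterm : ∀ X ∈ Lv.bad n, |Lv.E2n n X 0 y| ≤
      4 * remActivity c / α₂ ^ 2 * B₃ ^ 2 * Real.exp (-(min (c.κ / 2) (c.δ₀ / 2) * ((Lv.rad n : ℝ) - 2))) *
        (Real.exp (-(c.κ / 2) * torusTreeLen X.1) *
          Real.exp (-(c.δ₀ / 2) * distCT (Lv.N n) M 0 (nearT (M := M) 0 X))) := by
    intro X hX
    have hX' : ¬ Small (Lv.rad n) X.1 := fun h => (Lv.mem_bad.1 hX) ⟨hn, h⟩
    have hgeo := sub_lt_dist_add_treeLen (M := M) X hX'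
    have h := Lv.abs_term_le hC h22 hs n X 0 y
    have hd := torusTreeLen_nonneg X.1
    have hD := distCT_nonneg (N := Lv.N n) (M := M) 0 (nearT (M := M) 0 X)
    have h1 : min (c.κ / 2) (c.δ₀ / 2) * torusTreeLen X.1 ≤ c.κ / 2 * torusTreeLen X.1 :=
      mul_le_mul_of_nonneg_right (min_le_left _ _) hd
    have h2 : min (c.κ / 2) (c.δ₀ / 2) * distCT (Lv.N n) M 0 (nearT (M := M) 0 X) ≤
        c.δ₀ / 2 * distCT (Lv.N n) M 0 (nearT (M := M) 0 X) := mul_le_mul_of_nonneg_right (min_le_right _ _) hD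
    have h3 : min (c.κ / 2) (c.δ₀ / 2) * ((Lv.rad n : ℝ) - 2) ≤
        min (c.κ / 2) (c.δ₀ / 2) * (distCT (Lv.N n) M 0 (nearT (M := M) 0 X) + torusTreeLen X.1) :=
      mul_le_mul_of_nonneg_left hgeo.le hη
    have key : -c.κ * torusTreeLen X.1 + -c.δ₀ * distCT (Lv.N n) M 0 (nearT (M := M) 0 X) ≤
        -(min (c.κ / 2) (c.δ₀ / 2) * ((Lv.rad n : ℝ) - 2)) +
          (-(c.κ / 2) * torusTreeLen X.1 + -(c.δ₀ / 2) * distCT (Lv.N n) M 0 (nearT (M := M) 0 X)) := by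
      nlinarith
    calc |Lv.E2n n X 0 y| ≤ _ := h
      _ = 4 * remActivity c / α₂ ^ 2 * B₃ ^ 2 *
            Real.exp (-c.κ * torusTreeLen X.1 + -c.δ₀ * distCT (Lv.N n) M 0 (nearT (M := M) 0 X)) := by
          rw [Real.exp_add]; ring
      _ ≤ 4 * remActivity c / α₂ ^ 2 * B₃ ^ 2 *
            Real.exp (-(min (c.κ / 2) (c.δ₀ / 2) * ((Lv.rad n : ℝ) - 2)) +
              (-(c.κ / 2) * torusTreeLen X.1 + -(c.δ₀ / 2) * distCT (Lv.N n) M 0 (nearT (M := M) 0 X))) :=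
          mul_le_mul_of_nonneg_left (Real.exp_le_exp.2 key) hCE
      _ = _ := by rw [Real.exp_add, Real.exp_add]; ring
  -- the domain and cube sums on the torus
  have hsum := weight_sum_le (geomT d (Lv.N n) M) (K₀_pos _ _).le (cubeSumLeafT d (Lv.N n) M (half_pos hδ))
    (treeLeafT d (Lv.N n) hC.tree) (0 : TPt d (Lv.N n * M))
  have hpick : ∀ X : TDom d (Lv.N n), (geomT d (Lv.N n) M).distC 0 ((geomT d (Lv.N n) M).pick 0 X) =
      distCT (Lv.N n) M 0 (nearT (M := M) 0 X) := fun X => rfl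
  simp only [hpick, tsys_dj] at hsum
  have hw0 : ∀ X : TDom d (Lv.N n), 0 ≤
      4 * remActivity c / α₂ ^ 2 * B₃ ^ 2 * Real.exp (-(min (c.κ / 2) (c.δ₀ / 2) * ((Lv.rad n : ℝ) - 2))) *
        (Real.exp (-(c.κ / 2) * torusTreeLen X.1) *
          Real.exp (-(c.δ₀ / 2) * distCT (Lv.N n) M 0 (nearT (M := M) 0 X))) := fun X => by positivity
  calc ∑ X ∈ Lv.bad n, |Lv.E2n n X 0 y|
      ≤ ∑ X ∈ Lv.bad n, 4 * remActivity c / α₂ ^ 2 * B₃ ^ 2 *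
          Real.exp (-(min (c.κ / 2) (c.δ₀ / 2) * ((Lv.rad n : ℝ) - 2))) *
          (Real.exp (-(c.κ / 2) * torusTreeLen X.1) *
            Real.exp (-(c.δ₀ / 2) * distCT (Lv.N n) M 0 (nearT (M := M) 0 X))) := Finset.sum_le_sum hterm
    _ ≤ ∑ X, 4 * remActivity c / α₂ ^ 2 * B₃ ^ 2 *
          Real.exp (-(min (c.κ / 2) (c.δ₀ / 2) * ((Lv.rad n : ℝ) - 2))) *
          (Real.exp (-(c.κ / 2) * torusTreeLen X.1) *
            Real.exp (-(c.δ₀ / 2) * distCT (Lv.N n) M 0 (nearT (M := M) 0 X))) :=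
        Finset.sum_le_sum_of_subset_of_nonneg (Finset.subset_univ _) fun X _ _ => hw0 X
    _ = 4 * remActivity c / α₂ ^ 2 * B₃ ^ 2 * Real.exp (-(min (c.κ / 2) (c.δ₀ / 2) * ((Lv.rad n : ℝ) - 2))) *
          ∑ X : TDom d (Lv.N n), Real.exp (-(c.κ / 2) * torusTreeLen X.1) *
            Real.exp (-(c.δ₀ / 2) * distCT (Lv.N n) M 0 (nearT (M := M) 0 X)) := by rw [Finset.mul_sum]
    _ ≤ 4 * remActivity c / α₂ ^ 2 * B₃ ^ 2 * Real.exp (-(min (c.κ / 2) (c.δ₀ / 2) * ((Lv.rad n : ℝ) - 2))) *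
          (K₀ (4 * 2 ^ d) (2 * d) * K₁ d (c.δ₀ / 2)) :=
        mul_le_mul_of_nonneg_left hsum (by positivity)
    _ = _ := by ring

/-- **The wrapping mass tends to zero** (R_n → ∞ with N_n; η > 0). [folklore] -/
theorem PolLeavesTLoc.tendsto_bad_mass (hC : CondsL d c ℓ) (h22 : c.R22gen ℓ) (hs : SignsL c α₂ B₃) (z : Pt d) :
    Tendsto (fun n => ∑ X ∈ Lv.bad n, |Lv.E2n n X (proj (Lv.N n * M) 0) (proj (Lv.N n * M) z)|) atTop (𝓝 0) := by
  have hη : 0 < min (c.κ / 2) (c.δ₀ / 2) := lt_min (by linarith [hC.kappa_pos]) (by linarith [hs.δ₀_pos])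
  have hN3 : ∀ᶠ n in atTop, 3 ≤ Lv.N n := (tendsto_atTop.1 Lv.hNlim) 3
  have hrad : Tendsto (fun n => ((Lv.rad n : ℕ) : ℝ)) atTop atTop := by
    refine tendsto_natCast_atTop_atTop.comp ?_
    rw [tendsto_atTop_atTop]
    intro b
    obtain ⟨n₀, hn₀⟩ := (tendsto_atTop_atTop.1 Lv.hNlim) (2 * b + 3)
    refine ⟨n₀, fun n hn => ?_⟩
    have := hn₀ n hn
    unfold PolLeavesTLoc.rad
    omega
  have h0 : Tendsto (fun n => (Lv.rad n : ℝ) - 2) atTop atTop := by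
    simpa [sub_eq_add_neg] using tendsto_atTop_add_const_right atTop (-2 : ℝ) hrad
  have h1 : Tendsto (fun n => min (c.κ / 2) (c.δ₀ / 2) * ((Lv.rad n : ℝ) - 2)) atTop atTop :=
    Tendsto.const_mul_atTop hη h0
  have h2 := (Real.tendsto_exp_neg_atTop_nhds_zero.comp h1).const_mul
    (4 * remActivity c / α₂ ^ 2 * B₃ ^ 2 * K₀ (4 * 2 ^ d) (2 * d) * K₁ d (c.δ₀ / 2))
  rw [mul_zero] at h2
  refine squeeze_zero' (Eventually.of_forall fun n => Finset.sum_nonneg fun X _ => abs_nonneg _) ?_ h2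
  filter_upwards [hN3] with n hn
  rw [proj_zero]
  exact Lv.bad_mass_le hC h22 hs hn (proj (Lv.N n * M) z)

/-- **Every lattice domain is eventually good**: for n large the reduction of Y lies in the box of radius R_n and Y is its
lift. [folklore] -/
theorem PolLeavesTLoc.eventually_good (Y : LDom d) :
    ∀ᶠ n in atTop, tproj (Lv.N n) Y ∈ Lv.good n ∧ liftDom (tproj (Lv.N n) Y) = Y := by
  classical
  -- the size of Y
  set RY : ℕ := Y.1.sup fun y => Finset.univ.sup fun i => (y i).natAbs with hRYdef
  have hRY : ∀ y ∈ Y.1, ∀ i, |y i| ≤ (RY : ℤ) := by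
    intro y hy i
    have h1 : (y i).natAbs ≤ Finset.univ.sup (fun i => (y i).natAbs) :=
      Finset.le_sup (f := fun i => (y i).natAbs) (Finset.mem_univ i)
    have h2 : Finset.univ.sup (fun i => (y i).natAbs) ≤ RY :=
      Finset.le_sup (f := fun y : Pt d => Finset.univ.sup fun i => (y i).natAbs) hy
    rw [← Int.natCast_natAbs]
    exact_mod_cast h1.trans h2
  have h3 : ∀ᶠ n in atTop, 2 * RY + 3 ≤ Lv.N n := (tendsto_atTop.1 Lv.hNlim) _
  filter_upwards [h3] with n hn
  have hn3 : 3 ≤ Lv.N n := by omega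
  have hR : RY ≤ Lv.rad n := by
    unfold PolLeavesTLoc.rad
    omega
  have hbox : InBox (Lv.rad n) Y := fun y hy i => (hRY y hy i).trans (by exact_mod_cast hR)
  have hN := Lv.rad_spec hn3
  exact ⟨Lv.mem_good.2 ⟨hn3, small_tproj hN hbox⟩, liftDom_tproj hN hbox⟩

/-- **(5.1) PROVED — THE LIMIT T₁ ↗ ℤ^d OF THE POLARIZATION KERNELS EXISTS** under termwise locality: for every z ∈ ℤ^d,
Σ_{X̄ ∈ 𝐃(T_n)} 𝐄^{(2)}_n(X̄, 0 mod N_nM, z mod N_nM) → Π(z) := Σ'_{Y ∈ 𝐃(ℤ^d)} a_Y(z), the series absolutely convergent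
and dominated termwise by the summable majorant `major` (dominated convergence §1 on the dictionary §2: the good terms are
the injective pull-backs of the torus terms to 𝐃(ℤ^d), dominated by `major`; the wrapping mass vanishes).  No condition
beyond `CondsL`, `(1 − 10δ)ℓ = 1`, `SignsL`. [cite: Balaban1987RG1, (1.21) p.264 and (5.1) p.292] -/
theorem PolLeavesTLoc.tendsto_sum (hC : CondsL d c ℓ) (h22 : c.R22gen ℓ) (hs : SignsL c α₂ B₃) (z : Pt d) :
    Summable (fun Y => a Y z) ∧ (∀ Y, |a Y z| ≤ major d M c α₂ B₃ Y) ∧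
      Tendsto (fun n => ∑ X : TDom d (Lv.N n), Lv.E2n n X (proj (Lv.N n * M) 0) (proj (Lv.N n * M) z)) atTop
        (𝓝 (limKernel a z)) := by
  have hA := hC.remActivity_nonneg hs.A
  refine tendsto_sum_of_dominated_pullback (J := LDom d) (T := fun n => TDom d (Lv.N n))
    (fun n X => Lv.E2n n X (proj (Lv.N n * M) 0) (proj (Lv.N n * M) z)) Lv.good Lv.bad (fun n X => liftDom X)
    (fun n Y => tproj (Lv.N n) Y) (fun Y => a Y z) (major d M c α₂ B₃) (fun n X hX => ?_) (fun n => ?_)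
    Lv.eventually_good (fun Y => Lv.hloc Y z) (fun n X hX => ?_) (major_nonneg hA) (summable_major hs.δ₀_pos)
    (Lv.tendsto_bad_mass hC h22 hs z)
  · exact Lv.mem_bad.2 fun h => hX (Lv.mem_good.2 h)
  · intro X hX X' hX' h
    have h1 := Lv.mem_good.1 hX
    have h2 := Lv.mem_good.1 hX'
    exact liftDom_injOn (Lv.rad_spec h1.1) h1.2 h2.2 h
  · obtain ⟨hn, hsm⟩ := Lv.mem_good.1 hX
    rw [proj_zero]
    exact Lv.abs_term_le_major hC h22 hs hn hsm _

/-- The limit kernel is an absolutely convergent sum, termwise dominated by the majorant. [folklore] -/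
theorem PolLeavesTLoc.summable (Lv : PolLeavesTLoc d M a c ℓ α₂ B₃) (hC : CondsL d c ℓ) (h22 : c.R22gen ℓ) (hs : SignsL c α₂ B₃) (z : Pt d) :
    Summable (fun Y => a Y z) :=
  (Lv.tendsto_sum hC h22 hs z).1

/-- **THE TORUS LEAF LIST OF `RemainderChainTorus` RECOVERED, ITS (5.1)-FIELD A THEOREM**: termwise locality + the other
leaves give `PolLeavesT d M Π c ℓ α₂ B₃` for the DEFINED limit kernel Π = `limKernel a`. [cite: Balaban1987RG1, (5.1) p.292] -/
def PolLeavesTLoc.toPolLeavesT (Lv : PolLeavesTLoc d M a c ℓ α₂ B₃) (hC : CondsL d c ℓ) (h22 : c.R22gen ℓ)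
    (hs : SignsL c α₂ B₃) : PolLeavesT d M (limKernel a) c ℓ α₂ B₃ where
  N := Lv.N
  hN := Lv.hN
  hNlim := Lv.hNlim
  W := Lv.W
  hsp := Lv.hsp
  hrep := Lv.hrep
  h238 := Lv.h238
  Wn := Lv.Wn
  instW := Lv.instW
  instWs := Lv.instWs
  EXn := Lv.EXn
  emb := Lv.emb
  hemb := Lv.hemb
  hcomp := Lv.hcomp
  hn := Lv.hn
  E2n := Lv.E2n
  han := Lv.han
  hrepr := Lv.hrepr
  hh := Lv.hh
  hlim := fun z => (Lv.tendsto_sum hC h22 hs z).2.2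

end Leaves

/-! ## 5. The chain with termwise locality and the k-UNIFORM bound — the SAME fully valued coefficient -/

section Chain

variable {M : ℕ} [NeZero M]

/-- **THE REMAINDER CHAIN ON THE PERIODIC CARRIER WITH TERMWISE LOCALITY** (the twin of `RemainderChainTorus.ChainT`):
`A1 k p` = the infinite-volume localized polarization terms (μν-component) of the (2.13)-half at scale k + 1 and history p;
`beta1_eq` = the dictionary clause (1.22) applied to that half, read on the DEFINED limit kernel `limKernel (A1 k p)`;
`leaves k p hp` = the torus leaf list with termwise locality, THE SAME `c, ℓ, α₂, B₃, M` for every k and every history.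
A HYPOTHESIS structure. [cite: Balaban1987RG1, (1.20)-(1.22) p.264; Balaban1988RG2Cluster, (2.38) p.20] -/
structure ChainTLoc (d M : ℕ) [NeZero M] (μ ν : Fin d) {β : HBeta} (S : B12Beta.OneLoopSplit β) (γ : ℝ)
    (c : B13.Consts) (ℓ α₂ B₃ : ℝ) where
  A1 : (k : ℕ) → (Fin (k + 1) → ℝ) → LDom d → Pt d → ℝ
  beta1_eq : ∀ k p, p ∈ B12Beta.HistBox γ k →
    S.β1 k p = B12Beta.secondMoment (fun _ _ => limKernel (A1 k p)) μ ν
  leaves : ∀ k p, p ∈ B12Beta.HistBox γ k → PolLeavesTLoc d M (A1 k p) c ℓ α₂ B₃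

variable {μ ν : Fin d} {β : HBeta} {S : B12Beta.OneLoopSplit β} {γ : ℝ} {c : B13.Consts} {ℓ α₂ B₃ : ℝ}

/-- A chain with termwise locality IS a torus chain of `RemainderChainTorus` (its (5.1)-fields theorems). [folklore] -/
def ChainTLoc.toChainT (R : ChainTLoc d M μ ν S γ c ℓ α₂ B₃) (hC : CondsL d c ℓ) (h22 : c.R22gen ℓ)
    (hs : SignsL c α₂ B₃) : ChainT d M μ ν S γ c ℓ α₂ B₃ where
  P1 := fun k p _ _ => limKernel (R.A1 k p)
  beta1_eq := R.beta1_eq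
  leaves := fun k p hp => (R.leaves k p hp).toPolLeavesT hC h22 hs

/-- **THE k-UNIFORM REMAINDER BOUND WITH THE (5.1)-LEAF DERIVED, coefficient FULLY VALUED AND IDENTICAL TO
`ChainT.abs_beta1_le`'s**: `|β¹_{k+1}(g_0,…,g_k)| ≤ ε₁ · K_rem,L` for EVERY scale k and EVERY history in `]0,γ]^{k+1}`,
`K_rem,L = RemainderChainLattice.remCoeffL d M c α₂ B₃`.  O(ε₁), not O(g_k), not O(γ²).
[cite: Balaban1988RG2Cluster, (2.38) p.20; Balaban1987RG1, (5.10) p.293 and (1.22) p.264] -/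
theorem ChainTLoc.abs_beta1_le (R : ChainTLoc d M μ ν S γ c ℓ α₂ B₃) (hC : CondsL d c ℓ) (h22 : c.R22gen ℓ)
    (hs : SignsL c α₂ B₃) (hd : 0 < d) : RemainderConst S γ (c.ε₁ * remCoeffL d M c α₂ B₃) :=
  (R.toChainT hC h22 hs).abs_beta1_le hC h22 hs hd

/-- The one-sided form `−ε₁K_rem,L ≤ β¹_{k+1}` on the boxes (the binder shape of RULING (R10)'s remainder slot). [folklore] -/
theorem ChainTLoc.neg_le_beta1 (R : ChainTLoc d M μ ν S γ c ℓ α₂ B₃) (hC : CondsL d c ℓ) (h22 : c.R22gen ℓ)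
    (hs : SignsL c α₂ B₃) (hd : 0 < d) :
    ∀ k (p : Fin (k + 1) → ℝ), p ∈ B12Beta.HistBox γ k → -(c.ε₁ * remCoeffL d M c α₂ B₃) ≤ S.β1 k p :=
  fun k p hp => (abs_le.mp (R.abs_beta1_le hC h22 hs hd k p hp)).1

/-! ### The RULING (R10) END consumers, by name -/

/-- **`BetaPartialSumsLowerH` from telescoping + the chain with termwise locality**
(`RemainderChainTorus.betaPartialSumsLowerH_of_telescope_chainT` ∘ `toChainT`). [cite: Balaban1987RG1, Thm 2 p.259 (first sentence); Balaban1988RG2Cluster, (2.38) p.20] -/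
theorem betaPartialSumsLowerH_of_telescope_chainTLoc {γ₀ b A : ℝ} {B : ℕ → ℝ} {L : ℕ}
    (R : ChainTLoc d M μ ν S γ₀ c ℓ α₂ B₃) (hC : CondsL d c ℓ) (h22 : c.R22gen ℓ) (hs : SignsL c α₂ B₃) (hd : 0 < d)
    (hL : 2 ≤ L) (hA : 0 ≤ A) (hTel : ∀ k : ℕ, ∑ j ∈ Finset.range k, S.β0 j = B (L ^ k))
    (hB : ∀ n : ℕ, 2 ≤ n → |B n - b * Real.log n| ≤ A) (hε₁ : c.ε₁ * remCoeffL d M c α₂ B₃ ≤ b * Real.log L) :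
    BetaPartialSumsLowerH (2 * A) γ₀ β :=
  betaPartialSumsLowerH_of_telescope_chainT (R.toChainT hC h22 hs) hC h22 hs hd hL hA hTel hB hε₁

/-- **ENDPOINT EXISTENCE from telescoping + the chain with termwise locality**
(`RemainderChainTorus.endpointExistence_of_telescope_chainT` ∘ `toChainT`). [cite: Balaban1987RG1, Thm 2 p.259 (first sentence); Balaban1988RG2Cluster, (2.38) p.20] -/
theorem endpointExistence_of_telescope_chainTLoc {C : B12.Construction} (hgen : ForwardGenerated C β)
    {γ₀ b A β' : ℝ} {B : ℕ → ℝ} {L : ℕ} (R : ChainTLoc d M μ ν S γ₀ c ℓ α₂ B₃) (hC : CondsL d c ℓ)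
    (h22 : c.R22gen ℓ) (hs : SignsL c α₂ B₃) (hd : 0 < d) (hγ₀ : 0 < γ₀) (hL : 2 ≤ L) (hA : 0 ≤ A)
    (hTel : ∀ k : ℕ, ∑ j ∈ Finset.range k, S.β0 j = B (L ^ k))
    (hB : ∀ n : ℕ, 2 ≤ n → |B n - b * Real.log n| ≤ A)
    (hε₁ : c.ε₁ * remCoeffL d M c α₂ B₃ ≤ b * Real.log L) (hβ' : 0 ≤ β') (hcont : BetaContH γ₀ β)
    (hup : BetaUpperH β' γ₀ β) : EndpointExistence C :=
  endpointExistence_of_telescope_chainT hgen (R.toChainT hC h22 hs) hC h22 hs hd hγ₀ hL hA hTel hB hε₁ hβ' hcont hup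

end Chain

/-! ## 6. Non-vacuity of the new geometric notions -/

/-- The geometric dictionary is not vacuous: the one-cube domain {0} of ℤ^1 lies in every box, its reduction mod 5 is
good for R = 1, and lifts back to it. [folklore] -/
example : liftDom (tproj 5 (⟨{0}, Finset.singleton_nonempty 0, faceConnected_singleton 0⟩ : LDom 1)) =
    (⟨{0}, Finset.singleton_nonempty 0, faceConnected_singleton 0⟩ : LDom 1) :=
  liftDom_tproj (R := 1) (by norm_num) fun y hy i => by
    rw [Finset.mem_singleton] at hy
    subst hy
    simp

end

end Literature.MathematicalPhysics.QuantumFieldTheory.Balaban1983to89.Beta.RemainderLimitTorus
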